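import Summits.Langlands.Langlands.Theses.NonParallelVoid
import Literature.NumberTheory.GaloisRepresentations.LabelledWeightsTateTwist
import Literature.NumberTheory.GaloisRepresentations.PstWeilDeligneTateTwist
import Literature.NumberTheory.GaloisRepresentations.OrdinaryTwistedDeterminant

/-!
# `LocallyReducibleParallel` (crux stmt-Langlands-17002): the witness locus is stable under Tate
# twists (negative-side support, refuter cdisprove seat; sorry-free)

A WITNESS against the crux `Summit.Langlands.Langlands.Theses.NonParallelVoid.LocallyReducibleParallel`
over an imaginary quadratic `F` at `p` is a `ρ : Γ_F →ₜ* GL₂(ℚ̄_p)` that is irreducible,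
unramified a.e., de Rham at every `v ∣ p` for THE pinned datum with two distinct labelled weights at
every label, has an invariant line at every `v ∣ p`, and whose labels do NOT all carry weights
`{a, a + g}` for one `g`.  This file proves that the five defining clauses of a witness are each
transported along `ρ ↦ ρ ⊗ ε_p^{-k}` (`ε_p^{-k} = (cyclotomicPadicAlgCl F p ^ k)⁻¹`, accepted
`FramedRep.twist`), the de Rham clause under the T0 named fact `FontaineDatumExists` (accepted
`fontainePstAdicCompletion_isDeRhamFramed_tateTwist`), everything else unconditionally (labelled
weights shift by `+k`, accepted `labelledHodgeTateWeightsAt_twist_of_cyclotomic_zpow`; the same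
change of frame triangularises the twist; subrepresentations are the same submodules; `ε_p` is
unramified away from `p`):

* `locallyReducibleParallel_witness_twist` — a witness twists to a witness;
* `parallelLabels_twist_iff` — the crux's conclusion for `ρ ⊗ ε_p^{-k}` iff for `ρ`.

Consequences recorded for the crux chain (see the crux work file `Cruxes/LocallyReducibleParallel/
Disproof.lean`): twisting the Lean-constructible (label-independent, hence parallel)
representations never produces a witness; dually a prover may Tate-normalise one weight to `0` at a
chosen label without loss.  This file does NOT refute the crux.
-/

noncomputable section

set_option linter.dupNamespace false -- project-wide option; `Summit.Langlands.Langlands` is the mandated namespace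

namespace Summit.Langlands.Langlands.Theorems.LocallyReducibleParallel.Negative

open Literature.NumberTheory.GaloisRepresentations Literature.NumberTheory.PAdicHodge
open IsDedekindDomain Field
open scoped NumberField

section Twist

variable {F : Type} [Field F] [NumberField F] {p : ℕ} [Fact p.Prime]

/-- On a decomposition group at `v`, `ε_p^{-k}` is the `(-k)`-th power of the LOCAL cyclotomic
character (the shape `hε` of the accepted twist theorems). [folklore] -/
theorem chi_absGaloisRestrict (k : ℕ) (v : HeightOneSpectrum (𝓞 F))
    (σ : absoluteGaloisGroup (v.adicCompletion F)) :
    (((cyclotomicPadicAlgCl F p ^ k)⁻¹ : absoluteGaloisGroup F →ₜ* (PadicAlgCl p)ˣ)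
        (absGaloisRestrict F (v.adicCompletion F) σ) : PadicAlgCl p) =
      (algebraMap ℚ_[p] (PadicAlgCl p)
        ((GaloisRep.cyclotomicCharacter (v.adicCompletion F) p σ : ℤ_[p]ˣ) : ℤ_[p])) ^ (-(k : ℤ)) := by
  haveI : NeZero (p : F) := ⟨Nat.cast_ne_zero.mpr (Fact.out : p.Prime).ne_zero⟩
  change ((((cyclotomicPadicAlgCl F p ^ k) (absGaloisRestrict F (v.adicCompletion F) σ))⁻¹ :
    (PadicAlgCl p)ˣ) : PadicAlgCl p) = _
  rw [ContinuousMonoidHom.pow_apply, Units.val_inv_eq_inv_val, Units.val_pow_eq_pow_val,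
    coe_cyclotomicPadicAlgCl_apply, cyclotomicCharacter_absGaloisRestrict, zpow_neg, zpow_natCast]

/-- **Labelled weights of the twist**: `HT(ρ ⊗ ε_p^{-k}) = HT(ρ) + k` at every label of every
`v ∣ p` (accepted `labelledHodgeTateWeightsAt_twist_of_cyclotomic_zpow`, unconditional). [folklore] -/
theorem HT_twist (ρ : FramedGaloisRep F (PadicAlgCl p) 2) (k : ℕ) (v : HeightOneSpectrum (𝓞 F))
    (hv : ((p : ℕ) : 𝓞 F) ∈ v.asIdeal) (τ : v.adicCompletion F →+* PadicAlgCl p) :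
    FramedGaloisRep.labelledHodgeTateWeightsAt (FramedRep.twist ρ (cyclotomicPadicAlgCl F p ^ k)⁻¹) v (fontainePstAdicCompletion v p hv).algebra
          (fontainePstAdicCompletion v p hv).𝔅 τ = (FramedGaloisRep.labelledHodgeTateWeightsAt ρ v (fontainePstAdicCompletion v p hv).algebra
          (fontainePstAdicCompletion v p hv).𝔅 τ).map fun i : ℤ => i + (k : ℤ) := by
  have h := FramedGaloisRep.labelledHodgeTateWeightsAt_twist_of_cyclotomic_zpow ρ (cyclotomicPadicAlgCl F p ^ k)⁻¹
    (-(k : ℤ)) v hv (chi_absGaloisRestrict k v) τ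
  rw [h]
  congr 1
  funext i
  omega

/-- Translating a pair. [folklore] -/
theorem pair_map_add (a b c : ℤ) :
    (({a, b} : Multiset ℤ).map fun i => i + c) = {a + c, b + c} := by
  simp

/-- "Weights `{a, a+g}` at the label `(v, τ)`" is twist-invariant (same `g`). [folklore] -/
theorem parallelAt_twist_iff (ρ : FramedGaloisRep F (PadicAlgCl p) 2) (k : ℕ) (g : ℤ)
    (v : HeightOneSpectrum (𝓞 F)) (hv : ((p : ℕ) : 𝓞 F) ∈ v.asIdeal)
    (τ : v.adicCompletion F →+* PadicAlgCl p) :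
    (∃ a : ℤ, FramedGaloisRep.labelledHodgeTateWeightsAt (FramedRep.twist ρ (cyclotomicPadicAlgCl F p ^ k)⁻¹) v (fontainePstAdicCompletion v p hv).algebra
          (fontainePstAdicCompletion v p hv).𝔅 τ = {a, a + g}) ↔
      ∃ a : ℤ, FramedGaloisRep.labelledHodgeTateWeightsAt ρ v (fontainePstAdicCompletion v p hv).algebra
          (fontainePstAdicCompletion v p hv).𝔅 τ = {a, a + g} := by
  rw [HT_twist]
  constructor
  · rintro ⟨a, ha⟩
    refine ⟨a - k, Multiset.map_injective (add_left_injective (k : ℤ)) ?_⟩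
    rw [ha, pair_map_add, show a - (k : ℤ) + k = a by omega,
      show a - (k : ℤ) + g + k = a + g by omega]
  · rintro ⟨a, ha⟩
    refine ⟨a + k, ?_⟩
    rw [ha, pair_map_add, show a + g + (k : ℤ) = a + k + g by omega]

/-- "Two distinct weights at the label `(v, τ)`" is twist-invariant. [folklore] -/
theorem regularAt_twist_iff (ρ : FramedGaloisRep F (PadicAlgCl p) 2) (k : ℕ)
    (v : HeightOneSpectrum (𝓞 F)) (hv : ((p : ℕ) : 𝓞 F) ∈ v.asIdeal)
    (τ : v.adicCompletion F →+* PadicAlgCl p) :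
    (∃ a b : ℤ, a < b ∧ FramedGaloisRep.labelledHodgeTateWeightsAt (FramedRep.twist ρ (cyclotomicPadicAlgCl F p ^ k)⁻¹) v (fontainePstAdicCompletion v p hv).algebra
          (fontainePstAdicCompletion v p hv).𝔅 τ = {a, b}) ↔
      ∃ a b : ℤ, a < b ∧ FramedGaloisRep.labelledHodgeTateWeightsAt ρ v (fontainePstAdicCompletion v p hv).algebra
          (fontainePstAdicCompletion v p hv).𝔅 τ = {a, b} := by
  rw [HT_twist]
  constructor
  · rintro ⟨a, b, hab, h⟩
    refine ⟨a - k, b - k, by omega, Multiset.map_injective (add_left_injective (k : ℤ)) ?_⟩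
    rw [h, pair_map_add, sub_add_cancel, sub_add_cancel]
  · rintro ⟨a, b, hab, h⟩
    exact ⟨a + k, b + k, by omega, by rw [h, pair_map_add]⟩

/-- `toLocal` of a twist is the twist of `toLocal` (definitional). [folklore] -/
theorem toLocal_twist (ρ : FramedGaloisRep F (PadicAlgCl p) 2)
    (ε : absoluteGaloisGroup F →ₜ* (PadicAlgCl p)ˣ) (v : HeightOneSpectrum (𝓞 F)) :
    FramedGaloisRep.toLocal v (FramedRep.twist ρ ε) =
      FramedRep.twist (ρ.toLocal v) (ε.comp (absGaloisRestrict F (v.adicCompletion F))) :=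
  ContinuousMonoidHom.ext fun _ => rfl

/-- **De Rham-ness at `v ∣ p` is preserved by the twist** (under `FontaineDatumExists`, accepted
`fontainePstAdicCompletion_isDeRhamFramed_tateTwist`). [folklore] -/
theorem deRham_twist (hFD : FontaineDatumExists) (ρ : FramedGaloisRep F (PadicAlgCl p) 2) (k : ℕ)
    (v : HeightOneSpectrum (𝓞 F)) (hv : ((p : ℕ) : 𝓞 F) ∈ v.asIdeal)
    (h : (fontainePstAdicCompletion v p hv).IsDeRhamFramed (ρ.toLocal v)) :
    (fontainePstAdicCompletion v p hv).IsDeRhamFramed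
      (FramedGaloisRep.toLocal v (FramedRep.twist ρ (cyclotomicPadicAlgCl F p ^ k)⁻¹)) := by
  rw [toLocal_twist]
  exact fontainePstAdicCompletion_isDeRhamFramed_tateTwist hFD v hv h (-(k : ℤ)) _
    (fun σ => chi_absGaloisRestrict k v σ)

/-- **Invariant flags are preserved by the twist** (scalars are central: the same change of frame
triangularises `ρ ⊗ χ`). [folklore] -/
theorem flag_twist (ρ : FramedGaloisRep F (PadicAlgCl p) 2)
    (ε : absoluteGaloisGroup F →ₜ* (PadicAlgCl p)ˣ) (v : HeightOneSpectrum (𝓞 F))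
    (h : FramedRep.HasInvariantCompleteFlag (ρ.toLocal v)) :
    FramedRep.HasInvariantCompleteFlag (FramedGaloisRep.toLocal v (FramedRep.twist ρ ε)) := by
  obtain ⟨P, hP⟩ := h
  refine ⟨P, fun g i j hij => ?_⟩
  have key : (FramedRep.conj P (FramedGaloisRep.toLocal v (FramedRep.twist ρ ε))).matrixFn g i j =
      (ε (absGaloisRestrict F (v.adicCompletion F) g) : PadicAlgCl p) *
        (FramedRep.conj P (ρ.toLocal v)).matrixFn g i j := by
    rw [toLocal_twist, FramedRep.conj_twist, FramedRep.matrixFn_apply, FramedRep.coe_twist_apply,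
      Matrix.smul_apply, smul_eq_mul, FramedRep.matrixFn_apply]
    rfl
  rw [key, hP g i j hij, mul_zero]

omit [NumberField F] in
/-- **Irreducibility is preserved by the twist.** [folklore] -/
theorem irreducible_twist (ρ : FramedGaloisRep F (PadicAlgCl p) 2)
    (ε : absoluteGaloisGroup F →ₜ* (PadicAlgCl p)ˣ) (h : ρ.toGaloisRep.IsIrreducible) :
    (FramedGaloisRep.toGaloisRep (FramedRep.twist ρ ε)).IsIrreducible := by
  -- the two representations differ by the unit scalars `ε g`, so they have the SAME
  -- subrepresentations (as submodules): an order isomorphism of subrepresentation lattices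
  have h12 : ∀ (g : absoluteGaloisGroup F) (v : Fin 2 → PadicAlgCl p),
      (FramedGaloisRep.toGaloisRep (FramedRep.twist ρ ε)).toRepresentation g v =
        (ε g : PadicAlgCl p) • ρ.toGaloisRep.toRepresentation g v := fun g v => by
    change (FramedRep.twist ρ ε).toContinuousRep g v = (ε g : PadicAlgCl p) • ρ.toContinuousRep g v
    rw [FramedRep.toContinuousRep_apply_apply, FramedRep.toContinuousRep_apply_apply,
      FramedRep.coe_twist_apply, Matrix.smul_mulVec]
  let e : Subrepresentation ρ.toGaloisRep.toRepresentation ≃o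
      Subrepresentation (FramedGaloisRep.toGaloisRep (FramedRep.twist ρ ε)).toRepresentation :=
    { toFun := fun W => ⟨W.toSubmodule, fun g v hv => by
        rw [h12]
        exact W.toSubmodule.smul_mem _ (W.apply_mem_toSubmodule g hv)⟩
      invFun := fun W => ⟨W.toSubmodule, fun g v hv => by
        have e : ρ.toGaloisRep.toRepresentation g v = (((ε g)⁻¹ : (PadicAlgCl p)ˣ) : PadicAlgCl p) •
            (FramedGaloisRep.toGaloisRep (FramedRep.twist ρ ε)).toRepresentation g v := by
          rw [h12, smul_smul, Units.inv_mul, one_smul]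
        rw [e]
        exact W.toSubmodule.smul_mem _ (W.apply_mem_toSubmodule g hv)⟩
      left_inv := fun _ => rfl
      right_inv := fun _ => rfl
      map_rel_iff' := Iff.rfl }
  unfold ContinuousRep.IsIrreducible Representation.IsIrreducible at h ⊢
  exact e.isSimpleOrder_iff.1 h

/-- **Almost-everywhere unramifiedness is preserved by the twist** (`ε_p` is unramified away from
`p`: inertia prime to `p` fixes `μ_{p^∞}`, accepted
`smul_eq_self_of_mem_inertia_of_pow_prime_pow_eq_one`; finitely many places divide `p`). [folklore] -/
theorem unramified_twist (ρ : FramedGaloisRep F (PadicAlgCl p) 2) (k : ℕ)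
    (h : ∀ᶠ v : HeightOneSpectrum (𝓞 F) in Filter.cofinite, ρ.IsUnramifiedAt v) :
    ∀ᶠ v : HeightOneSpectrum (𝓞 F) in Filter.cofinite,
      FramedGaloisRep.IsUnramifiedAt v (FramedRep.twist ρ (cyclotomicPadicAlgCl F p ^ k)⁻¹) := by
  -- only finitely many places lie above `p`
  have hfin : ∀ᶠ v : HeightOneSpectrum (𝓞 F) in Filter.cofinite, ((p : ℕ) : 𝓞 F) ∉ v.asIdeal := by
    have hI : Ideal.span {((p : ℕ) : 𝓞 F)} ≠ ⊥ := by
      rw [Ne, Ideal.span_singleton_eq_bot]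
      exact_mod_cast (Fact.out : p.Prime).ne_zero
    rw [Filter.eventually_cofinite]
    refine (Ideal.finite_factors hI).subset fun v hv => ?_
    simp only [Set.mem_setOf_eq, not_not] at hv ⊢
    exact (Ideal.dvd_span_singleton).mpr hv
  filter_upwards [h, hfin] with v hv hvp
  intro 𝔓 h𝔓 σ hσ
  -- inertia prime to `p` fixes the `p`-power roots of unity, so `ε_p(σ) = 1`
  have hc : GaloisRep.cyclotomicCharacter F p σ = 1 := by
    rw [GaloisRep.cyclotomicCharacter_apply]
    refine cyclotomicCharacter_eq_one_of_forall_pow_eq_one p _ fun n t ht => ?_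
    exact smul_eq_self_of_mem_inertia_of_pow_prime_pow_eq_one hvp h𝔓 hσ ht
  have hε : ((cyclotomicPadicAlgCl F p ^ k)⁻¹ : absoluteGaloisGroup F →ₜ* (PadicAlgCl p)ˣ) σ = 1 := by
    refine Units.ext ?_
    change ((((cyclotomicPadicAlgCl F p ^ k) σ)⁻¹ : (PadicAlgCl p)ˣ) : PadicAlgCl p) = _
    rw [ContinuousMonoidHom.pow_apply, Units.val_inv_eq_inv_val, Units.val_pow_eq_pow_val,
      coe_cyclotomicPadicAlgCl_apply, hc, Units.val_one, PadicInt.coe_one, map_one, one_pow, inv_one,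
      Units.val_one]
  have h1 : ρ σ = 1 := hv 𝔓 h𝔓 σ hσ
  rw [FramedRep.twist_apply, h1, mul_one, hε, map_one]

end Twist

section Witness

variable {F : Type} [Field F] [NumberField F] {p : ℕ} [Fact p.Prime]

/-- **The crux's conclusion is twist-invariant**: every label of `ρ ⊗ ε_p^{-k}` carries weights
`{a, a + g}` (one `g`) iff every label of `ρ` does. [folklore] -/
theorem parallelLabels_twist_iff (ρ : FramedGaloisRep F (PadicAlgCl p) 2) (k : ℕ) :
    (∃ g : ℤ, ∀ (v : HeightOneSpectrum (𝓞 F)) (hv : ((p : ℕ) : 𝓞 F) ∈ v.asIdeal),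
        letI := (fontainePstAdicCompletion v p hv).algebra
        ∀ τ : v.adicCompletion F →ₐ[ℚ_[p]] PadicAlgCl p,
          ∃ a : ℤ, FramedGaloisRep.labelledHodgeTateWeightsAt (FramedRep.twist ρ (cyclotomicPadicAlgCl F p ^ k)⁻¹) v (fontainePstAdicCompletion v p hv).algebra
          (fontainePstAdicCompletion v p hv).𝔅 τ.toRingHom = {a, a + g}) ↔
      ∃ g : ℤ, ∀ (v : HeightOneSpectrum (𝓞 F)) (hv : ((p : ℕ) : 𝓞 F) ∈ v.asIdeal),
        letI := (fontainePstAdicCompletion v p hv).algebra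
        ∀ τ : v.adicCompletion F →ₐ[ℚ_[p]] PadicAlgCl p,
          ∃ a : ℤ, FramedGaloisRep.labelledHodgeTateWeightsAt ρ v (fontainePstAdicCompletion v p hv).algebra
          (fontainePstAdicCompletion v p hv).𝔅 τ.toRingHom = {a, a + g} := by
  refine exists_congr fun g => forall_congr' fun v => forall_congr' fun hv =>
    forall_congr' fun τ => ?_
  letI := (fontainePstAdicCompletion v p hv).algebra
  exact parallelAt_twist_iff ρ k g v hv τ.toRingHom

/-- **A witness against `LocallyReducibleParallel` twists to a witness** (under the T0 fact
`FontaineDatumExists`, used only for the de Rham clause): if `ρ : Γ_F →ₜ* GL₂(ℚ̄_p)` is irreducible,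
unramified a.e., de Rham-regular at every label for the pinned datum, has an invariant line at every
`v ∣ p`, and its labels do NOT all carry weights `{a, a + g}` for one `g`, then the same five clauses
hold for `ρ ⊗ ε_p^{-k}`.  (No such `ρ` is known or constructible; the statement says the locus where
the crux could fail is closed under Tate twists — equivalently, proving the crux for all Tate twists
of `ρ` is the same as proving it for `ρ`.) [folklore] -/
theorem locallyReducibleParallel_witness_twist (hFD : FontaineDatumExists)
    (ρ : FramedGaloisRep F (PadicAlgCl p) 2) (k : ℕ)
    (hirr : ρ.toGaloisRep.IsIrreducible)
    (hunr : ∀ᶠ v : HeightOneSpectrum (𝓞 F) in Filter.cofinite, ρ.IsUnramifiedAt v)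
    (hreg : ∀ (v : HeightOneSpectrum (𝓞 F)) (hv : ((p : ℕ) : 𝓞 F) ∈ v.asIdeal),
      (fontainePstAdicCompletion v p hv).IsDeRhamFramed (ρ.toLocal v) ∧
        (letI := (fontainePstAdicCompletion v p hv).algebra
         ∀ τ : v.adicCompletion F →ₐ[ℚ_[p]] PadicAlgCl p,
           ∃ a b : ℤ, a < b ∧ FramedGaloisRep.labelledHodgeTateWeightsAt ρ v (fontainePstAdicCompletion v p hv).algebra
          (fontainePstAdicCompletion v p hv).𝔅 τ.toRingHom = {a, b}))
    (hflag : ∀ v : HeightOneSpectrum (𝓞 F), ((p : ℕ) : 𝓞 F) ∈ v.asIdeal →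
      FramedRep.HasInvariantCompleteFlag (ρ.toLocal v))
    (hnp : ¬ ∃ g : ℤ, ∀ (v : HeightOneSpectrum (𝓞 F)) (hv : ((p : ℕ) : 𝓞 F) ∈ v.asIdeal),
      letI := (fontainePstAdicCompletion v p hv).algebra
      ∀ τ : v.adicCompletion F →ₐ[ℚ_[p]] PadicAlgCl p, ∃ a : ℤ, FramedGaloisRep.labelledHodgeTateWeightsAt ρ v (fontainePstAdicCompletion v p hv).algebra
          (fontainePstAdicCompletion v p hv).𝔅 τ.toRingHom = {a, a + g}) :
    (FramedGaloisRep.toGaloisRep (FramedRep.twist ρ (cyclotomicPadicAlgCl F p ^ k)⁻¹)).IsIrreducible ∧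
    (∀ᶠ v : HeightOneSpectrum (𝓞 F) in Filter.cofinite,
      FramedGaloisRep.IsUnramifiedAt v (FramedRep.twist ρ (cyclotomicPadicAlgCl F p ^ k)⁻¹)) ∧
    (∀ (v : HeightOneSpectrum (𝓞 F)) (hv : ((p : ℕ) : 𝓞 F) ∈ v.asIdeal),
      (fontainePstAdicCompletion v p hv).IsDeRhamFramed
          (FramedGaloisRep.toLocal v (FramedRep.twist ρ (cyclotomicPadicAlgCl F p ^ k)⁻¹)) ∧
        (letI := (fontainePstAdicCompletion v p hv).algebra
         ∀ τ : v.adicCompletion F →ₐ[ℚ_[p]] PadicAlgCl p,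
           ∃ a b : ℤ, a < b ∧ FramedGaloisRep.labelledHodgeTateWeightsAt (FramedRep.twist ρ (cyclotomicPadicAlgCl F p ^ k)⁻¹) v (fontainePstAdicCompletion v p hv).algebra
          (fontainePstAdicCompletion v p hv).𝔅 τ.toRingHom = {a, b})) ∧
    (∀ v : HeightOneSpectrum (𝓞 F), ((p : ℕ) : 𝓞 F) ∈ v.asIdeal →
      FramedRep.HasInvariantCompleteFlag (FramedGaloisRep.toLocal v (FramedRep.twist ρ (cyclotomicPadicAlgCl F p ^ k)⁻¹))) ∧
    ¬ ∃ g : ℤ, ∀ (v : HeightOneSpectrum (𝓞 F)) (hv : ((p : ℕ) : 𝓞 F) ∈ v.asIdeal),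
      letI := (fontainePstAdicCompletion v p hv).algebra
      ∀ τ : v.adicCompletion F →ₐ[ℚ_[p]] PadicAlgCl p,
        ∃ a : ℤ, FramedGaloisRep.labelledHodgeTateWeightsAt (FramedRep.twist ρ (cyclotomicPadicAlgCl F p ^ k)⁻¹) v (fontainePstAdicCompletion v p hv).algebra
          (fontainePstAdicCompletion v p hv).𝔅 τ.toRingHom = {a, a + g} := by
  refine ⟨irreducible_twist ρ _ hirr, unramified_twist ρ k hunr, fun v hv => ?_,
    fun v hv => flag_twist ρ _ v (hflag v hv), fun h => hnp ((parallelLabels_twist_iff ρ k).1 h)⟩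
  letI := (fontainePstAdicCompletion v p hv).algebra
  exact ⟨deRham_twist hFD ρ k v hv (hreg v hv).1,
    fun τ => (regularAt_twist_iff ρ k v hv τ.toRingHom).2 ((hreg v hv).2 τ)⟩

end Witness

end Summit.Langlands.Langlands.Theorems.LocallyReducibleParallel.Negative

end
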